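import Literature.Analysis.FluidPDE.TaoMultiplierToolkit
import Mathlib.Analysis.InnerProductSpace.Calculus
import Mathlib.Analysis.Calculus.Deriv.Mul
import Mathlib.MeasureTheory.Integral.IntervalIntegral.FundThmCalculus
import HarnessLib

/-!
# Tao's averaged Navier–Stokes blow-up: the heat flow on a frequency band and Duhamel's formula

Support file for the discharge of **Lemma 4.1 (equations of motion)** of
T. Tao, *Finite time blowup for an averaged three-dimensional Navier–Stokes equation*,
J. Amer. Math. Soc. **29** (2016), 601–674 = arXiv:1402.0290v3 (held as `paper:arxiv-1402.0290`),
§4 p. 22: the projected Duhamel formula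
`u_{i,n}(t) = e^{tΔ} X_{i,n}(0) ψ_{i,n} + Σ α (1+ε₀)^{5(n-μ₃)/2} ∫₀ᵗ X X (t') e^{(t-t')Δ} ψ_{i,n} dt'`
and its differentiated form (4.15) `∂ₜ u_{i,n} = Δ u_{i,n} + G(t) ψ_{i,n}` ("In particular this
shows that `u_{i,n}` is continuously differentiable in time (in the `L²ₓ` topology, say)").

On a bounded frequency band `R ⊆ {|ξ| ≤ ρ}` the Laplacian is the **bounded** multiplier
`L_R = (-4π²|ξ|² 1_R)(D)` with `‖L_R‖ ≤ 4π²ρ²`, and the heat flow restricted to the band,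
`S_R(τ) = (1_R e^{-4π²τ|ξ|²})(D)`, is defined for **all** `τ ∈ ℝ` and is a norm-differentiable
group. This turns the Duhamel integral into `S_R(t) (x₀ + ∫₀ᵗ g(s) S_R(-s) ψ ds)`, whose
`L²`-derivative is the product rule. Contents (all proved):

* `heatRate`, `bandHeat R τ` (`= S_R(τ)`), `bandLaplace R` (`= L_R`), `bandProj R` (`= 1_R(D)`):
  group law `bandHeat_add`, `bandHeat_zero`, agreement with the accepted heat flow
  `bandHeat τ f = e^{τΔ} 1_R(D) f` for `τ ≥ 0` (`bandHeat_eq_heat_bandProj`), operator-norm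
  derivative `hasDerivAt_bandHeat` (`∂_τ S_R(τ) = L_R S_R(τ)`), self-adjointness, `Re ⟪f, L_R f⟫ ≤ 0`,
  band-limitedness / realness / divergence-freeness of the outputs;
* `duhamelW`, `duhamelV` — `V(t) = S_R(t)(x₀ + ∫₀ᵗ g(s) S_R(-s)ψ ds) = S_R(t)x₀ + ∫₀ᵗ g(s) S_R(t-s)ψ ds`
  (`duhamelV_eq`), with `∂ₜ V = L_R V + g(t) 1_R(D)ψ` (`hasDerivAt_duhamelV`), and the derivatives
  of `t ↦ ‖V(t)‖²` and `t ↦ ⟪φ, V(t)⟫` (`hasDerivAt_norm_sq_duhamelV`, `hasDerivAt_inner_duhamelV`).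

## References

* T. Tao, J. Amer. Math. Soc. 29 (2016), 601–674, arXiv:1402.0290v3, §4 p. 22 ((4.14), (4.15)),
  (1.15). Key `Tao2016AveragedNS`.
-/

noncomputable section

open MeasureTheory Set Filter FourierTransform
open scoped ENNReal NNReal ComplexConjugate InnerProductSpace Topology

namespace Literature.Analysis.FluidPDE.Tao2016

/-- Local notation for physical / frequency space `ℝ³`. -/
local notation "ℝ³" => EuclideanSpace ℝ (Fin 3)
/-- Local notation for the complexified range `ℂ³`. -/
local notation "ℂ³" => EuclideanSpace ℂ (Fin 3)

/-! ### Symbols on a bounded band -/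

/-- The heat decay rate `4π²|ξ|²` of the frequency `ξ` (`\widehat{e^{τΔ}f}(ξ) = e^{-4π²τ|ξ|²} f̂(ξ)`
in Tao's normalisation of `𝓕`, (1.5)). [cite: Tao2016AveragedNS, (1.5)] -/
def heatRate (ξ : ℝ³) : ℝ := 4 * Real.pi ^ 2 * ‖ξ‖ ^ 2

/-- `0 ≤ 4π²|ξ|²`. [folklore] -/
theorem heatRate_nonneg (ξ : ℝ³) : 0 ≤ heatRate ξ := by
  unfold heatRate; positivity

/-- The heat rate is even. [folklore] -/
theorem heatRate_neg (ξ : ℝ³) : heatRate (-ξ) = heatRate ξ := by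
  unfold heatRate; rw [norm_neg]

/-- The heat rate is continuous. [folklore] -/
theorem continuous_heatRate : Continuous heatRate := by
  unfold heatRate; fun_prop

/-- On the ball `{|ξ| ≤ ρ}` the heat rate is at most `4π²ρ²`. [folklore] -/
theorem heatRate_le {ρ : ℝ} {ξ : ℝ³} (h : ξ ∈ Metric.closedBall (0 : ℝ³) ρ) :
    heatRate ξ ≤ 4 * Real.pi ^ 2 * ρ ^ 2 := by
  unfold heatRate
  have hn : ‖ξ‖ ≤ ρ := by simpa using h
  exact mul_le_mul_of_nonneg_left (pow_le_pow_left₀ (norm_nonneg ξ) hn 2) (by positivity)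

section Band

variable {R : Set ℝ³} (hR : MeasurableSet R) {ρ : ℝ} (hρ : R ⊆ Metric.closedBall (0 : ℝ³) ρ)

/-- The symbol `1_R(ξ) e^{-4π²τ|ξ|²}` of the heat flow restricted to the band `R`, for every
real time `τ` (bounded because `R` is bounded). [cite: Tao2016AveragedNS, §4 p. 22] -/
def bandHeatFn (R : Set ℝ³) (τ : ℝ) (ξ : ℝ³) : ℂ :=
  R.indicator (fun η => ((Real.exp (-(heatRate η * τ)) : ℝ) : ℂ)) ξ

/-- The symbol `-4π²|ξ|² 1_R(ξ)` of the Laplacian restricted to the band `R`. [cite: Tao2016AveragedNS, §4 p. 22] -/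
def bandLaplaceFn (R : Set ℝ³) (ξ : ℝ³) : ℂ :=
  R.indicator (fun η => ((-heatRate η : ℝ) : ℂ)) ξ

/-- The symbol `-4π²|ξ|² 1_R(ξ) e^{-4π²τ|ξ|²}` of `L_R S_R(τ)`. [folklore] -/
def bandHeatDerivFn (R : Set ℝ³) (τ : ℝ) (ξ : ℝ³) : ℂ :=
  R.indicator (fun η => ((-heatRate η * Real.exp (-(heatRate η * τ)) : ℝ) : ℂ)) ξ

include hρ in
/-- On the band, `e^{-4π²τ|ξ|²} ≤ e^{4π²ρ²|τ|}`. [folklore] -/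
theorem exp_neg_heatRate_mul_le {ξ : ℝ³} (hξ : ξ ∈ R) (τ : ℝ) :
    Real.exp (-(heatRate ξ * τ)) ≤ Real.exp (4 * Real.pi ^ 2 * ρ ^ 2 * |τ|) := by
  refine Real.exp_le_exp.2 ?_
  have h1 : -(heatRate ξ * τ) ≤ heatRate ξ * |τ| := by
    have := neg_abs_le τ
    nlinarith [heatRate_nonneg ξ, abs_nonneg τ]
  exact h1.trans (mul_le_mul_of_nonneg_right (heatRate_le (hρ hξ)) (abs_nonneg τ))

include hR hρ in
/-- The band heat symbol is an `L^∞` symbol, bounded by `e^{4π²ρ²|τ|}`. [folklore] -/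
theorem memLp_bandHeatFn (τ : ℝ) : MemLp (bandHeatFn R τ) ∞ (volume : Measure ℝ³) := by
  refine memLp_top_of_bound ?_ (Real.exp (4 * Real.pi ^ 2 * ρ ^ 2 * |τ|))
    (Eventually.of_forall fun ξ => ?_)
  · refine AEStronglyMeasurable.indicator ?_ hR
    exact (Complex.continuous_ofReal.comp
      (Real.continuous_exp.comp ((continuous_heatRate.mul continuous_const).neg))).aestronglyMeasurable
  · unfold bandHeatFn
    by_cases hξ : ξ ∈ R
    · rw [indicator_of_mem hξ, Complex.norm_real, Real.norm_eq_abs, abs_of_pos (Real.exp_pos _)]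
      exact exp_neg_heatRate_mul_le hρ hξ τ
    · rw [indicator_of_notMem hξ, norm_zero]
      exact (Real.exp_pos _).le

include hR hρ in
/-- The band Laplacian symbol is an `L^∞` symbol, bounded by `4π²ρ²`. [folklore] -/
theorem memLp_bandLaplaceFn : MemLp (bandLaplaceFn R) ∞ (volume : Measure ℝ³) := by
  refine memLp_top_of_bound ?_ (4 * Real.pi ^ 2 * ρ ^ 2) (Eventually.of_forall fun ξ => ?_)
  · refine AEStronglyMeasurable.indicator ?_ hR
    exact (Complex.continuous_ofReal.comp continuous_heatRate.neg).aestronglyMeasurable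
  · unfold bandLaplaceFn
    by_cases hξ : ξ ∈ R
    · rw [indicator_of_mem hξ, Complex.norm_real, Real.norm_eq_abs, abs_neg,
        abs_of_nonneg (heatRate_nonneg ξ)]
      exact heatRate_le (hρ hξ)
    · rw [indicator_of_notMem hξ, norm_zero]
      positivity

include hR hρ in
/-- The symbol of `L_R S_R(τ)` is an `L^∞` symbol, bounded by `4π²ρ² e^{4π²ρ²|τ|}`. [folklore] -/
theorem memLp_bandHeatDerivFn (τ : ℝ) : MemLp (bandHeatDerivFn R τ) ∞ (volume : Measure ℝ³) := by
  refine memLp_top_of_bound ?_ (4 * Real.pi ^ 2 * ρ ^ 2 * Real.exp (4 * Real.pi ^ 2 * ρ ^ 2 * |τ|))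
    (Eventually.of_forall fun ξ => ?_)
  · refine AEStronglyMeasurable.indicator ?_ hR
    exact (Complex.continuous_ofReal.comp (continuous_heatRate.neg.mul
      (Real.continuous_exp.comp ((continuous_heatRate.mul continuous_const).neg)))).aestronglyMeasurable
  · unfold bandHeatDerivFn
    by_cases hξ : ξ ∈ R
    · rw [indicator_of_mem hξ, Complex.norm_real, Real.norm_eq_abs, abs_mul, abs_neg,
        abs_of_nonneg (heatRate_nonneg ξ), abs_of_pos (Real.exp_pos _)]
      exact mul_le_mul (heatRate_le (hρ hξ)) (exp_neg_heatRate_mul_le hρ hξ τ) (Real.exp_pos _).le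
        (by positivity)
    · rw [indicator_of_notMem hξ, norm_zero]
      positivity

/-- **The heat flow restricted to the band**, `S_R(τ) = (1_R e^{-4π²τ|ξ|²})(D)`, a bounded
operator on `L²(ℝ³; ℂ³)` for every real `τ` (for `τ ≥ 0` it is `e^{τΔ} 1_R(D)`,
`bandHeat_eq_heat_bandProj`). [cite: Tao2016AveragedNS, §4 p. 22] -/
def bandHeat (τ : ℝ) : L2C →L[ℂ] L2C :=
  fourierMultiplierCLM ((memLp_bandHeatFn hR hρ τ).toLp _)

/-- **The Laplacian restricted to the band**, `L_R = (-4π²|ξ|² 1_R)(D)`, a bounded operator. [cite: Tao2016AveragedNS, §4 p. 22] -/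
def bandLaplace : L2C →L[ℂ] L2C :=
  fourierMultiplierCLM ((memLp_bandLaplaceFn hR hρ).toLp _)

/-- The Fourier projection `1_R(D)` onto the band, as a bounded operator. [cite: Tao2016AveragedNS, Lemma 4.1] -/
def bandProj : L2C →L[ℂ] L2C :=
  fourierMultiplierCLM ((memLp_top_indicator_one hR).toLp _)

/-- `1_R(D) f` is the accepted `fourierMultiplier` with indicator symbol (so for
`R = (1+ε₀)ⁿ(Bᵢ ∪ -Bᵢ)` it is the accepted `modeProjection`). [folklore] -/
theorem bandProj_apply (f : L2C) :
    bandProj hR f = fourierMultiplier ((memLp_top_indicator_one hR).toLp _) f := rfl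

/-! ### Algebra of the band operators -/

/-- `S_R(0) = 1_R(D)`. [folklore] -/
theorem bandHeat_zero : bandHeat hR hρ 0 = bandProj hR := by
  ext1 f
  change fourierMultiplier _ f = fourierMultiplier _ f
  refine fourierMultiplier_congr ?_ f
  filter_upwards [MemLp.coeFn_toLp (memLp_bandHeatFn hR hρ 0),
    MemLp.coeFn_toLp (memLp_top_indicator_one hR)] with ξ h1 h2
  rw [h1, h2]
  unfold bandHeatFn
  simp only [mul_zero, neg_zero, Real.exp_zero, Complex.ofReal_one]

/-- **Group law**: `S_R(a + b) = S_R(a) S_R(b)` for all real `a, b`. [folklore] -/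
theorem bandHeat_add (a b : ℝ) : bandHeat hR hρ (a + b) = (bandHeat hR hρ a).comp (bandHeat hR hρ b) := by
  ext1 f
  change fourierMultiplier _ f = fourierMultiplier _ (fourierMultiplier _ f)
  refine (fourierMultiplier_fourierMultiplier _ _ _ ?_ f).symm
  filter_upwards [MemLp.coeFn_toLp (memLp_bandHeatFn hR hρ (a + b)),
    MemLp.coeFn_toLp (memLp_bandHeatFn hR hρ a), MemLp.coeFn_toLp (memLp_bandHeatFn hR hρ b)]
    with ξ h1 h2 h3
  rw [h1, h2, h3]
  unfold bandHeatFn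
  by_cases hξ : ξ ∈ R
  · simp only [indicator_of_mem hξ]
    rw [← Complex.ofReal_mul, ← Real.exp_add]
    congr 2
    ring
  · simp only [indicator_of_notMem hξ, mul_zero]

/-- `S_R(a) S_R(b) = S_R(b) S_R(a)` (both are `S_R(a+b)`). [folklore] -/
theorem bandHeat_comm_apply (a b : ℝ) (f : L2C) :
    bandHeat hR hρ a (bandHeat hR hρ b f) = bandHeat hR hρ b (bandHeat hR hρ a f) := by
  have h1 := congrArg (fun T : L2C →L[ℂ] L2C => T f) (bandHeat_add hR hρ a b)
  have h2 := congrArg (fun T : L2C →L[ℂ] L2C => T f) (bandHeat_add hR hρ b a)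
  simp only [ContinuousLinearMap.coe_comp, Function.comp_apply] at h1 h2
  rw [← h1, ← h2, add_comm]

/-- `S_R(t) S_R(-s) = S_R(t - s)`. [folklore] -/
theorem bandHeat_apply_bandHeat_neg (t s : ℝ) (f : L2C) :
    bandHeat hR hρ t (bandHeat hR hρ (-s) f) = bandHeat hR hρ (t - s) f := by
  have h := congrArg (fun T : L2C →L[ℂ] L2C => T f) (bandHeat_add hR hρ t (-s))
  simp only [ContinuousLinearMap.coe_comp, Function.comp_apply] at h
  rw [← h, sub_eq_add_neg]

/-- **For `τ ≥ 0` the band heat flow is the accepted heat flow after the band projection**: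
`S_R(τ) f = e^{τΔ} 1_R(D) f`. [cite: Tao2016AveragedNS, §4 p. 22] -/
theorem bandHeat_eq_heat_bandProj {τ : ℝ} (hτ : 0 ≤ τ) (f : L2C) :
    bandHeat hR hρ τ f = heat τ (bandProj hR f) := by
  change fourierMultiplier _ f = fourierMultiplier _ (fourierMultiplier _ f)
  refine (fourierMultiplier_fourierMultiplier _ _ _ ?_ f).symm
  filter_upwards [MemLp.coeFn_toLp (memLp_bandHeatFn hR hρ τ),
    MemLp.coeFn_toLp (memLp_top_heatSymbol τ), MemLp.coeFn_toLp (memLp_top_indicator_one hR)]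
    with ξ h1 h2 h3
  rw [h1, h2, h3]
  unfold bandHeatFn heatSymbol heatRate
  by_cases hξ : ξ ∈ R
  · simp only [indicator_of_mem hξ, mul_one, max_eq_left hτ]
    congr 2
    ring
  · simp only [indicator_of_notMem hξ, mul_zero]

/-- For `τ ≥ 0`, `S_R(τ) f = 1_R(D) e^{τΔ} f` as well (multipliers commute). [cite: Tao2016AveragedNS, §4 p. 22] -/
theorem bandHeat_eq_bandProj_heat {τ : ℝ} (hτ : 0 ≤ τ) (f : L2C) :
    bandHeat hR hρ τ f = bandProj hR (heat τ f) := by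
  change fourierMultiplier _ f = fourierMultiplier _ (fourierMultiplier _ f)
  refine (fourierMultiplier_fourierMultiplier _ _ _ ?_ f).symm
  filter_upwards [MemLp.coeFn_toLp (memLp_bandHeatFn hR hρ τ),
    MemLp.coeFn_toLp (memLp_top_heatSymbol τ), MemLp.coeFn_toLp (memLp_top_indicator_one hR)]
    with ξ h1 h2 h3
  rw [h1, h2, h3]
  unfold bandHeatFn heatSymbol heatRate
  by_cases hξ : ξ ∈ R
  · simp only [indicator_of_mem hξ, one_mul, max_eq_left hτ]
    congr 2
    ring
  · simp only [indicator_of_notMem hξ, zero_mul]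

/-- `1_R(D) S_R(τ) = S_R(τ)`. [folklore] -/
theorem bandProj_bandHeat (τ : ℝ) (f : L2C) : bandProj hR (bandHeat hR hρ τ f) = bandHeat hR hρ τ f := by
  change fourierMultiplier _ (fourierMultiplier _ f) = fourierMultiplier _ f
  refine fourierMultiplier_fourierMultiplier _ _ _ ?_ f
  filter_upwards [MemLp.coeFn_toLp (memLp_bandHeatFn hR hρ τ),
    MemLp.coeFn_toLp (memLp_top_indicator_one hR)] with ξ h1 h2
  rw [h1, h2]
  unfold bandHeatFn
  by_cases hξ : ξ ∈ R
  · simp only [indicator_of_mem hξ, one_mul]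
  · simp only [indicator_of_notMem hξ, mul_zero]

/-- `S_R(τ) 1_R(D) = S_R(τ)`. [folklore] -/
theorem bandHeat_bandProj (τ : ℝ) (f : L2C) : bandHeat hR hρ τ (bandProj hR f) = bandHeat hR hρ τ f := by
  change fourierMultiplier _ (fourierMultiplier _ f) = fourierMultiplier _ f
  refine fourierMultiplier_fourierMultiplier _ _ _ ?_ f
  filter_upwards [MemLp.coeFn_toLp (memLp_bandHeatFn hR hρ τ),
    MemLp.coeFn_toLp (memLp_top_indicator_one hR)] with ξ h1 h2
  rw [h1, h2]
  unfold bandHeatFn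
  by_cases hξ : ξ ∈ R
  · simp only [indicator_of_mem hξ, mul_one]
  · simp only [indicator_of_notMem hξ, mul_zero]

/-- `L_R S_R(τ)` is the multiplier with symbol `-4π²|ξ|² 1_R e^{-4π²τ|ξ|²}`. [folklore] -/
theorem bandLaplace_bandHeat (τ : ℝ) (f : L2C) :
    bandLaplace hR hρ (bandHeat hR hρ τ f) = fourierMultiplier ((memLp_bandHeatDerivFn hR hρ τ).toLp _) f := by
  change fourierMultiplier _ (fourierMultiplier _ f) = fourierMultiplier _ f
  refine fourierMultiplier_fourierMultiplier _ _ _ ?_ f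
  filter_upwards [MemLp.coeFn_toLp (memLp_bandHeatFn hR hρ τ),
    MemLp.coeFn_toLp (memLp_bandLaplaceFn hR hρ), MemLp.coeFn_toLp (memLp_bandHeatDerivFn hR hρ τ)]
    with ξ h1 h2 h3
  rw [h1, h2, h3]
  unfold bandHeatFn bandLaplaceFn bandHeatDerivFn
  by_cases hξ : ξ ∈ R
  · simp only [indicator_of_mem hξ, ← Complex.ofReal_mul]
  · simp only [indicator_of_notMem hξ, mul_zero]

/-! ### Norms, adjoints, sign -/

/-- `‖L_R‖ ≤ 4π²ρ²`: on the band the Laplacian is a bounded operator. [folklore] -/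
theorem norm_bandLaplace_le : ‖bandLaplace hR hρ‖ ≤ 4 * Real.pi ^ 2 * ρ ^ 2 := by
  refine norm_fourierMultiplierCLM_le_of_bound _ (by positivity) ?_
  filter_upwards [MemLp.coeFn_toLp (memLp_bandLaplaceFn hR hρ)] with ξ h1
  rw [h1]
  unfold bandLaplaceFn
  by_cases hξ : ξ ∈ R
  · rw [indicator_of_mem hξ, Complex.norm_real, Real.norm_eq_abs, abs_neg,
      abs_of_nonneg (heatRate_nonneg ξ)]
    exact heatRate_le (hρ hξ)
  · rw [indicator_of_notMem hξ, norm_zero]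
    positivity

/-- `‖1_R(D)‖ ≤ 1`. [folklore] -/
theorem norm_bandProj_le : ‖bandProj hR‖ ≤ 1 := by
  refine norm_fourierMultiplierCLM_le_of_bound _ zero_le_one ?_
  filter_upwards [MemLp.coeFn_toLp (memLp_top_indicator_one hR)] with ξ h1
  rw [h1]
  by_cases hξ : ξ ∈ R
  · rw [indicator_of_mem hξ, norm_one]
  · rw [indicator_of_notMem hξ, norm_zero]
    exact zero_le_one

/-- `L_R` is self-adjoint (real symbol). [folklore] -/
theorem inner_bandLaplace_comm (f g : L2C) :
    ⟪bandLaplace hR hρ f, g⟫_ℂ = ⟪f, bandLaplace hR hρ g⟫_ℂ := by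
  refine inner_fourierMultiplier_comm _ ?_ f g
  filter_upwards [MemLp.coeFn_toLp (memLp_bandLaplaceFn hR hρ)] with ξ h1
  rw [h1]
  unfold bandLaplaceFn
  by_cases hξ : ξ ∈ R
  · rw [indicator_of_mem hξ, Complex.conj_ofReal]
  · rw [indicator_of_notMem hξ, map_zero]

/-- `S_R(τ)` is self-adjoint (real symbol). [folklore] -/
theorem inner_bandHeat_comm (τ : ℝ) (f g : L2C) :
    ⟪bandHeat hR hρ τ f, g⟫_ℂ = ⟪f, bandHeat hR hρ τ g⟫_ℂ := by
  refine inner_fourierMultiplier_comm _ ?_ f g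
  filter_upwards [MemLp.coeFn_toLp (memLp_bandHeatFn hR hρ τ)] with ξ h1
  rw [h1]
  unfold bandHeatFn
  by_cases hξ : ξ ∈ R
  · rw [indicator_of_mem hξ, Complex.conj_ofReal]
  · rw [indicator_of_notMem hξ, map_zero]

/-- `1_R(D)` is self-adjoint. [folklore] -/
theorem inner_bandProj_comm (f g : L2C) :
    ⟪bandProj hR f, g⟫_ℂ = ⟪f, bandProj hR g⟫_ℂ := by
  refine inner_fourierMultiplier_comm _ ?_ f g
  filter_upwards [MemLp.coeFn_toLp (memLp_top_indicator_one hR)] with ξ h1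
  rw [h1]
  by_cases hξ : ξ ∈ R
  · rw [indicator_of_mem hξ, map_one]
  · rw [indicator_of_notMem hξ, map_zero]

/-- **`⟨L_R f, f⟩ ≤ 0`**: `Re ⟪f, L_R f⟫ ≤ 0` and `⟪f, L_R f⟫` is real (Tao p. 22:
"noting that `⟨Δ u_{i,n}, u_{i,n}⟩ ≤ 0`"). [cite: Tao2016AveragedNS, §4 p. 22] -/
theorem inner_bandLaplace_self (f : L2C) :
    (⟪f, bandLaplace hR hρ f⟫_ℂ).re ≤ 0 ∧ (⟪f, bandLaplace hR hρ f⟫_ℂ).im = 0 := by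
  refine inner_fourierMultiplier_self_of_nonpos _ (fun ξ => R.indicator (fun η => -heatRate η) ξ) ?_
    (fun ξ => ?_) f
  · filter_upwards [MemLp.coeFn_toLp (memLp_bandLaplaceFn hR hρ)] with ξ h1
    rw [h1]
    unfold bandLaplaceFn
    by_cases hξ : ξ ∈ R
    · simp only [indicator_of_mem hξ]
    · simp only [indicator_of_notMem hξ, Complex.ofReal_zero]
  · by_cases hξ : ξ ∈ R
    · rw [indicator_of_mem hξ, neg_nonpos]
      exact heatRate_nonneg ξ
    · rw [indicator_of_notMem hξ]

/-! ### Band-limitedness, realness, divergence-freeness of the outputs -/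

/-- `S_R(τ) f` is band-limited to `R`. [folklore] -/
theorem isBandLimited_bandHeat (τ : ℝ) (f : L2C) : IsBandLimited R (bandHeat hR hρ τ f) := by
  refine IsBandLimited.of_symbol _ ?_ f
  filter_upwards [MemLp.coeFn_toLp (memLp_bandHeatFn hR hρ τ)] with ξ h1 hξ
  rw [h1]
  exact indicator_of_notMem hξ _

/-- `L_R f` is band-limited to `R`. [folklore] -/
theorem isBandLimited_bandLaplace (f : L2C) : IsBandLimited R (bandLaplace hR hρ f) := by
  refine IsBandLimited.of_symbol _ ?_ f
  filter_upwards [MemLp.coeFn_toLp (memLp_bandLaplaceFn hR hρ)] with ξ h1 hξ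
  rw [h1]
  exact indicator_of_notMem hξ _

/-- `1_R(D) f` is band-limited to `R`. [folklore] -/
theorem isBandLimited_bandProj (f : L2C) : IsBandLimited R (bandProj hR f) := by
  refine IsBandLimited.of_symbol _ ?_ f
  filter_upwards [MemLp.coeFn_toLp (memLp_top_indicator_one hR)] with ξ h1 hξ
  rw [h1]
  exact indicator_of_notMem hξ _

/-- A field band-limited to `R` is fixed by `1_R(D)`. [folklore] -/
theorem IsBandLimited.bandProj_eq {f : L2C} (hf : IsBandLimited R f) : bandProj hR f = f := by
  refine hf.fourierMultiplier_eq_self _ ?_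
  filter_upwards [MemLp.coeFn_toLp (memLp_top_indicator_one hR)] with ξ h1 hξ
  rw [h1]
  exact indicator_of_mem hξ _

/-- `S_R(τ)` preserves realness when the band is symmetric (its symbol is real and even). [folklore] -/
theorem IsReal.bandHeat (hRsymm : ∀ ξ, ξ ∈ R ↔ -ξ ∈ R) {f : L2C} (hf : IsReal f) (τ : ℝ) :
    IsReal (Tao2016.bandHeat hR hρ τ f) := by
  refine hf.fourierMultiplier_of_ae _ ?_
  filter_upwards [MemLp.coeFn_toLp (memLp_bandHeatFn hR hρ τ),
    (Measure.measurePreserving_neg (volume : Measure ℝ³)).quasiMeasurePreserving.ae_eq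
      (MemLp.coeFn_toLp (memLp_bandHeatFn hR hρ τ))] with ξ h1 h2
  simp only [Function.comp_apply] at h2
  rw [h1, h2]
  unfold bandHeatFn
  by_cases hξ : ξ ∈ R
  · rw [indicator_of_mem hξ, indicator_of_mem ((hRsymm ξ).1 hξ), heatRate_neg, Complex.conj_ofReal]
  · rw [indicator_of_notMem hξ, indicator_of_notMem (fun h => hξ ((hRsymm ξ).2 h)), map_zero]

/-- `1_R(D)` preserves realness when the band is symmetric. [folklore] -/
theorem IsReal.bandProj (hRsymm : ∀ ξ, ξ ∈ R ↔ -ξ ∈ R) {f : L2C} (hf : IsReal f) :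
    IsReal (Tao2016.bandProj hR f) := by
  refine hf.fourierMultiplier_of_ae _ ?_
  filter_upwards [MemLp.coeFn_toLp (memLp_top_indicator_one hR),
    (Measure.measurePreserving_neg (volume : Measure ℝ³)).quasiMeasurePreserving.ae_eq
      (MemLp.coeFn_toLp (memLp_top_indicator_one hR))] with ξ h1 h2
  simp only [Function.comp_apply] at h2
  rw [h1, h2]
  by_cases hξ : ξ ∈ R
  · rw [indicator_of_mem hξ, indicator_of_mem ((hRsymm ξ).1 hξ), map_one]
  · rw [indicator_of_notMem hξ, indicator_of_notMem (fun h => hξ ((hRsymm ξ).2 h)), map_zero]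

/-- Sums of divergence-free fields are divergence free. [folklore] -/
theorem IsFourierDivFree.add {f g : L2C} (hf : IsFourierDivFree f) (hg : IsFourierDivFree g) :
    IsFourierDivFree (f + g) := by
  unfold IsFourierDivFree at *
  filter_upwards [hf, hg, fourierFn_add f g] with ξ h1 h2 h3
  rw [h3, cdot_add_right, h1, h2, add_zero]

/-- Scalar multiples of divergence-free fields are divergence free. [folklore] -/
theorem IsFourierDivFree.smul {f : L2C} (hf : IsFourierDivFree f) (c : ℂ) :
    IsFourierDivFree (c • f) := by
  unfold IsFourierDivFree at *
  filter_upwards [hf, fourierFn_smul c f] with ξ h1 h2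
  rw [h2, cdot_smul_right, h1, mul_zero]

/-- `S_R(τ)` preserves divergence-freeness. [folklore] -/
theorem IsFourierDivFree.bandHeat {f : L2C} (hf : IsFourierDivFree f) (τ : ℝ) :
    IsFourierDivFree (Tao2016.bandHeat hR hρ τ f) :=
  hf.fourierMultiplier _

/-- `1_R(D)` preserves divergence-freeness. [folklore] -/
theorem IsFourierDivFree.bandProj {f : L2C} (hf : IsFourierDivFree f) :
    IsFourierDivFree (Tao2016.bandProj hR f) :=
  hf.fourierMultiplier _

/-! ### The band heat flow is norm-differentiable: `∂_τ S_R(τ) = L_R S_R(τ)` -/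

/-- Taylor remainder of the exponential on the band: for `0 ≤ r ≤ A`, `A|h| ≤ 1`,
`|e^{-r(τ+h)} - e^{-rτ} + h r e^{-rτ}| ≤ e^{A|τ|} A² h²`. [folklore] -/
theorem abs_exp_step_sub_le {r A τ h : ℝ} (hr0 : 0 ≤ r) (hrA : r ≤ A) (hh : A * |h| ≤ 1)
    (hexp : Real.exp (-(r * τ)) ≤ Real.exp (A * |τ|)) :
    |Real.exp (-(r * (τ + h))) - Real.exp (-(r * τ)) - h * (-r * Real.exp (-(r * τ)))| ≤
      Real.exp (A * |τ|) * A ^ 2 * h ^ 2 := by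
  have hx : |-(r * h)| ≤ 1 := by
    rw [abs_neg, abs_mul, abs_of_nonneg hr0]
    exact (mul_le_mul_of_nonneg_right hrA (abs_nonneg h)).trans hh
  have hT := Real.abs_exp_sub_one_sub_id_le hx
  have heq : Real.exp (-(r * (τ + h))) - Real.exp (-(r * τ)) - h * (-r * Real.exp (-(r * τ))) =
      Real.exp (-(r * τ)) * (Real.exp (-(r * h)) - 1 - -(r * h)) := by
    rw [show -(r * (τ + h)) = -(r * τ) + -(r * h) by ring, Real.exp_add]
    ring
  rw [heq, abs_mul, abs_of_pos (Real.exp_pos _)]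
  have h2 : (-(r * h)) ^ 2 ≤ A ^ 2 * h ^ 2 := by
    rw [neg_sq, mul_pow]
    exact mul_le_mul_of_nonneg_right (pow_le_pow_left₀ hr0 hrA 2) (sq_nonneg h)
  calc Real.exp (-(r * τ)) * |Real.exp (-(r * h)) - 1 - -(r * h)|
      ≤ Real.exp (A * |τ|) * (A ^ 2 * h ^ 2) :=
        mul_le_mul hexp (hT.trans h2) (abs_nonneg _) (Real.exp_pos _).le
    _ = Real.exp (A * |τ|) * A ^ 2 * h ^ 2 := by ring

/-- The increment `S_R(τ+h) f - S_R(τ) f - h L_R S_R(τ) f` is `𝓕⁻¹` of the corresponding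
combination of symbols applied to `f̂`. [folklore] -/
theorem bandHeat_step_apply (τ h : ℝ) (f : L2C) :
    bandHeat hR hρ (τ + h) f - bandHeat hR hρ τ f - (h : ℂ) • bandLaplace hR hρ (bandHeat hR hρ τ f) =
      (𝓕⁻ (((memLp_bandHeatFn hR hρ (τ + h)).toLp _ • (𝓕 f : L2C) : L2C) -
        ((memLp_bandHeatFn hR hρ τ).toLp _ • (𝓕 f : L2C) : L2C) -
        (h : ℂ) • ((memLp_bandHeatDerivFn hR hρ τ).toLp _ • (𝓕 f : L2C) : L2C)) : L2C) := by
  rw [bandLaplace_bandHeat]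
  change fourierMultiplier _ f - fourierMultiplier _ f - (h : ℂ) • fourierMultiplier _ f =
    (Lp.fourierTransformₗᵢ ℝ³ ℂ³).symm _
  rw [map_sub, map_sub, LinearIsometryEquiv.map_smul]
  rfl

include hρ in
/-- Pointwise bound for the combined symbol of the increment. [folklore] -/
theorem norm_bandHeat_step_symbol_le {τ h : ℝ} (hh : 4 * Real.pi ^ 2 * ρ ^ 2 * |h| ≤ 1) (ξ : ℝ³) :
    ‖bandHeatFn R (τ + h) ξ - bandHeatFn R τ ξ - (h : ℂ) * bandHeatDerivFn R τ ξ‖ ≤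
      Real.exp (4 * Real.pi ^ 2 * ρ ^ 2 * |τ|) * (4 * Real.pi ^ 2 * ρ ^ 2) ^ 2 * h ^ 2 := by
  unfold bandHeatFn bandHeatDerivFn
  by_cases hξ : ξ ∈ R
  · simp only [indicator_of_mem hξ]
    rw [← Complex.ofReal_mul, ← Complex.ofReal_sub, ← Complex.ofReal_sub, Complex.norm_real,
      Real.norm_eq_abs]
    exact abs_exp_step_sub_le (heatRate_nonneg ξ) (heatRate_le (hρ hξ)) hh
      (exp_neg_heatRate_mul_le hρ hξ τ)
  · simp only [indicator_of_notMem hξ, sub_zero, mul_zero, norm_zero]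
    positivity

/-- **Operator-norm bound for the increment**:
`‖S_R(τ+h) - S_R(τ) - h L_R S_R(τ)‖ ≤ e^{A|τ|} A² h²` for `A|h| ≤ 1`, `A = 4π²ρ²`. [folklore] -/
theorem norm_bandHeat_step_le {τ h : ℝ} (hh : 4 * Real.pi ^ 2 * ρ ^ 2 * |h| ≤ 1) :
    ‖bandHeat hR hρ (τ + h) - bandHeat hR hρ τ - (h : ℂ) • (bandLaplace hR hρ).comp (bandHeat hR hρ τ)‖ ≤
      Real.exp (4 * Real.pi ^ 2 * ρ ^ 2 * |τ|) * (4 * Real.pi ^ 2 * ρ ^ 2) ^ 2 * h ^ 2 := by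
  refine ContinuousLinearMap.opNorm_le_bound _ (by positivity) fun f => ?_
  simp only [FunLike.coe_sub, Pi.sub_apply, FunLike.coe_smul, Pi.smul_apply,
    ContinuousLinearMap.coe_comp, Function.comp_apply]
  rw [bandHeat_step_apply, norm_fourierInv_eq, ← Lp.norm_fourier_eq f]
  refine Lp.norm_le_mul_norm_of_ae_le_mul ?_
  filter_upwards [Lp.coeFn_sub (((memLp_bandHeatFn hR hρ (τ + h)).toLp _ • (𝓕 f : L2C) : L2C) -
      ((memLp_bandHeatFn hR hρ τ).toLp _ • (𝓕 f : L2C) : L2C))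
      ((h : ℂ) • ((memLp_bandHeatDerivFn hR hρ τ).toLp _ • (𝓕 f : L2C) : L2C)),
    Lp.coeFn_sub (((memLp_bandHeatFn hR hρ (τ + h)).toLp _ • (𝓕 f : L2C) : L2C))
      (((memLp_bandHeatFn hR hρ τ).toLp _ • (𝓕 f : L2C) : L2C)),
    Lp.coeFn_smul (h : ℂ) (((memLp_bandHeatDerivFn hR hρ τ).toLp _ • (𝓕 f : L2C) : L2C)),
    Lp.coeFn_lpSMul (r := 2) ((memLp_bandHeatFn hR hρ (τ + h)).toLp _) (𝓕 f : L2C),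
    Lp.coeFn_lpSMul (r := 2) ((memLp_bandHeatFn hR hρ τ).toLp _) (𝓕 f : L2C),
    Lp.coeFn_lpSMul (r := 2) ((memLp_bandHeatDerivFn hR hρ τ).toLp _) (𝓕 f : L2C),
    MemLp.coeFn_toLp (memLp_bandHeatFn hR hρ (τ + h)), MemLp.coeFn_toLp (memLp_bandHeatFn hR hρ τ),
    MemLp.coeFn_toLp (memLp_bandHeatDerivFn hR hρ τ)] with ξ h1 h2 h3 h4 h5 h6 h7 h8 h9
  rw [h1, Pi.sub_apply, h2, Pi.sub_apply, h3, Pi.smul_apply, h4, h5, h6, Pi.smul_apply',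
    Pi.smul_apply', Pi.smul_apply', h7, h8, h9, smul_smul, ← sub_smul, ← sub_smul, norm_smul]
  exact mul_le_mul_of_nonneg_right (norm_bandHeat_step_symbol_le hρ hh ξ) (norm_nonneg _)

/-- **The band heat flow is differentiable in operator norm, `∂_τ S_R(τ) = L_R S_R(τ)`** (on a
bounded band the generator is bounded). [cite: Tao2016AveragedNS, §4 p. 22 (4.15)] -/
theorem hasDerivAt_bandHeat (τ : ℝ) :
    HasDerivAt (fun σ => bandHeat hR hρ σ) ((bandLaplace hR hρ).comp (bandHeat hR hρ τ)) τ := by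
  rw [hasDerivAt_iff_isLittleO_nhds_zero]
  set A : ℝ := 4 * Real.pi ^ 2 * ρ ^ 2 with hA
  set K : ℝ := Real.exp (A * |τ|) * A ^ 2 with hK
  have hK0 : 0 ≤ K := by positivity
  refine Asymptotics.isLittleO_iff.2 fun c hc => ?_
  have hε : 0 < min (1 / (A + 1)) (c / (K + 1)) := lt_min (by positivity) (by positivity)
  rw [Metric.eventually_nhds_iff]
  refine ⟨_, hε, fun h hdist => ?_⟩
  rw [dist_zero_right, Real.norm_eq_abs] at hdist
  have hh1 : |h| < 1 / (A + 1) := hdist.trans_le (min_le_left _ _)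
  have hh2 : |h| < c / (K + 1) := hdist.trans_le (min_le_right _ _)
  have hAh : A * |h| ≤ 1 := by
    have hA0 : 0 ≤ A := by positivity
    have : A * |h| ≤ A * (1 / (A + 1)) := mul_le_mul_of_nonneg_left hh1.le hA0
    refine this.trans ?_
    rw [mul_one_div, div_le_one (by positivity)]
    linarith
  have hstep := norm_bandHeat_step_le hR hρ (τ := τ) hAh
  have hsm : (h : ℂ) • (bandLaplace hR hρ).comp (bandHeat hR hρ τ) =
      h • (bandLaplace hR hρ).comp (bandHeat hR hρ τ) := rfl
  rw [hsm] at hstep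
  refine hstep.trans ?_
  rw [Real.norm_eq_abs, ← hK, show K * h ^ 2 = (K * |h|) * |h| by rw [← sq_abs]; ring]
  refine mul_le_mul_of_nonneg_right ?_ (abs_nonneg h)
  have : K * |h| ≤ K * (c / (K + 1)) := mul_le_mul_of_nonneg_left hh2.le hK0
  refine this.trans ?_
  rw [mul_div_assoc']
  rw [div_le_iff₀ (by positivity)]
  nlinarith

/-- The band heat flow is continuous in operator norm. [folklore] -/
theorem continuous_bandHeat : Continuous fun σ => bandHeat hR hρ σ :=
  continuous_iff_continuousAt.2 fun τ => (hasDerivAt_bandHeat hR hρ τ).continuousAt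

/-- `σ ↦ S_R(σ) f` is continuous for every `f`. [folklore] -/
theorem continuous_bandHeat_apply (f : L2C) : Continuous fun σ => bandHeat hR hρ σ f :=
  (continuous_bandHeat hR hρ).clm_apply continuous_const

/-! ### Duhamel's formula on the band -/

/-- The **Duhamel pre-image** `W(t) = x₀ + ∫₀ᵗ g(s) S_R(-s) ψ ds` (so that `S_R(t) W(t)` is the
mild solution of `∂ₜ v = L_R v + g ψ`, `v(0) = 1_R(D) x₀` on the band). [cite: Tao2016AveragedNS, §4 p. 22 (4.14)] -/
def duhamelW (g : ℝ → ℂ) (x₀ ψ : L2C) (t : ℝ) : L2C :=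
  x₀ + ∫ s in (0 : ℝ)..t, g s • bandHeat hR hρ (-s) ψ

/-- **Duhamel's formula on the band**: `V(t) = S_R(t) W(t) = S_R(t) x₀ + ∫₀ᵗ g(s) S_R(t-s) ψ ds`
(Tao's `u_{i,n}(t) = e^{tΔ} u_{i,n}(0) + Σ … ∫₀ᵗ X X e^{(t-t')Δ} ψ_{i,n} dt'`, p. 22). [cite: Tao2016AveragedNS, §4 p. 22 (4.14)] -/
def duhamelV (g : ℝ → ℂ) (x₀ ψ : L2C) (t : ℝ) : L2C :=
  bandHeat hR hρ t (duhamelW hR hρ g x₀ ψ t)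

section Duhamel

variable {g : ℝ → ℂ} (hg : Continuous g) (x₀ ψ : L2C)

/-- The Duhamel integrand `s ↦ g(s) S_R(-s) ψ` is continuous. [folklore] -/
theorem continuous_duhamel_integrand (hg : Continuous g) (ψ : L2C) :
    Continuous fun s => g s • bandHeat hR hρ (-s) ψ :=
  hg.smul ((continuous_bandHeat hR hρ).comp continuous_neg |>.clm_apply continuous_const)

include hg in
/-- `∂ₜ W = g(t) S_R(-t) ψ` (fundamental theorem of calculus in `L²`). [folklore] -/
theorem hasDerivAt_duhamelW (t : ℝ) :
    HasDerivAt (duhamelW hR hρ g x₀ ψ) (g t • bandHeat hR hρ (-t) ψ) t := by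
  have hc := continuous_duhamel_integrand hR hρ hg ψ
  have h := intervalIntegral.integral_hasDerivAt_right (hc.intervalIntegrable 0 t)
    (hc.stronglyMeasurableAtFilter volume (𝓝 t)) hc.continuousAt
  exact h.const_add x₀

include hg in
/-- **The differentiated Duhamel formula on the band**: `∂ₜ V = L_R V + g(t) 1_R(D) ψ` in `L²`
(Tao's (4.15), `∂ₜ u_{i,n} = Δ u_{i,n} + G(t) ψ_{i,n}`). [cite: Tao2016AveragedNS, §4 p. 22 (4.15)] -/
theorem hasDerivAt_duhamelV (t : ℝ) :
    HasDerivAt (duhamelV hR hρ g x₀ ψ)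
      (bandLaplace hR hρ (duhamelV hR hρ g x₀ ψ t) + g t • bandProj hR ψ) t := by
  -- the band heat flow as a curve of real-linear operators, to apply the product rule over `ℝ`
  have hS : HasDerivAt (fun σ => (bandHeat hR hρ σ).restrictScalars ℝ)
      (((bandLaplace hR hρ).comp (bandHeat hR hρ t)).restrictScalars ℝ) t :=
    (ContinuousLinearMap.restrictScalarsIsometry ℂ L2C L2C ℝ ℝ).toContinuousLinearMap.hasFDerivAt
      |>.comp_hasDerivAt t (hasDerivAt_bandHeat hR hρ t)
  have h := hS.clm_apply (hasDerivAt_duhamelW hR hρ hg x₀ ψ t)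
  have heq : ((bandLaplace hR hρ).comp (bandHeat hR hρ t)).restrictScalars ℝ (duhamelW hR hρ g x₀ ψ t) +
      (bandHeat hR hρ t).restrictScalars ℝ (g t • bandHeat hR hρ (-t) ψ) =
      bandLaplace hR hρ (duhamelV hR hρ g x₀ ψ t) + g t • bandProj hR ψ := by
    rw [ContinuousLinearMap.coe_restrictScalars', ContinuousLinearMap.coe_restrictScalars',
      ContinuousLinearMap.coe_comp, Function.comp_apply, ContinuousLinearMap.map_smul,
      bandHeat_apply_bandHeat_neg, sub_self, bandHeat_zero]
    rfl
  rw [heq] at h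
  exact h

include hg in
/-- `V` is continuous. [folklore] -/
theorem continuous_duhamelV : Continuous (duhamelV hR hρ g x₀ ψ) :=
  continuous_iff_continuousAt.2 fun t => (hasDerivAt_duhamelV hR hρ hg x₀ ψ t).continuousAt

include hg in
/-- **Duhamel's formula, integral form**: `V(t) = S_R(t) x₀ + ∫₀ᵗ g(s) S_R(t - s) ψ ds`. [cite: Tao2016AveragedNS, §4 p. 22 (4.14)] -/
theorem duhamelV_eq (t : ℝ) :
    duhamelV hR hρ g x₀ ψ t = bandHeat hR hρ t x₀ + ∫ s in (0 : ℝ)..t, g s • bandHeat hR hρ (t - s) ψ := by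
  unfold duhamelV duhamelW
  rw [ContinuousLinearMap.map_add, ← ContinuousLinearMap.intervalIntegral_comp_comm _
    ((continuous_duhamel_integrand hR hρ hg ψ).intervalIntegrable 0 t)]
  congr 1
  refine intervalIntegral.integral_congr fun s _ => ?_
  simp only [ContinuousLinearMap.map_smul, bandHeat_apply_bandHeat_neg]

/-- `V(t)` is band-limited to `R`. [folklore] -/
theorem isBandLimited_duhamelV (t : ℝ) : IsBandLimited R (duhamelV hR hρ g x₀ ψ t) :=
  isBandLimited_bandHeat hR hρ t _

include hg in
/-- `V(t)` is divergence free if `x₀` and `ψ` are (divergence-freeness passes through the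
Duhamel integral, `isFourierDivFree_intervalIntegral`). [folklore] -/
theorem isFourierDivFree_duhamelV (hx₀ : IsFourierDivFree x₀) (hψ : IsFourierDivFree ψ) (t : ℝ) :
    IsFourierDivFree (duhamelV hR hρ g x₀ ψ t) := by
  refine IsFourierDivFree.bandHeat hR hρ (hx₀.add ?_) t
  exact isFourierDivFree_intervalIntegral
    ((continuous_duhamel_integrand hR hρ hg ψ).intervalIntegrable 0 t)
    fun s _ => (hψ.bandHeat hR hρ (-s)).smul (g s)

/-! ### Energy and coefficient derivatives along the Duhamel flow -/

include hg in
/-- **Derivative of the local energy along the band flow**: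
`∂ₜ ‖V‖² = 2 Re ⟪V, L_R V⟫ + 2 Re (g ⟪V, 1_R(D)ψ⟫)` (Tao p. 22: "taking inner products of (4.15)
with `u_{i,n}`"). [cite: Tao2016AveragedNS, §4 p. 22 (4.11)] -/
theorem hasDerivAt_norm_sq_duhamelV (t : ℝ) :
    HasDerivAt (fun s => ‖duhamelV hR hρ g x₀ ψ s‖ ^ 2)
      (2 * (⟪duhamelV hR hρ g x₀ ψ t, bandLaplace hR hρ (duhamelV hR hρ g x₀ ψ t)⟫_ℂ).re +
        2 * (g t * ⟪duhamelV hR hρ g x₀ ψ t, bandProj hR ψ⟫_ℂ).re) t := by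
  set V := duhamelV hR hρ g x₀ ψ with hV
  set D := bandLaplace hR hρ (V t) + g t • bandProj hR ψ with hD
  have hd : HasDerivAt V D t := hasDerivAt_duhamelV hR hρ hg x₀ ψ t
  have hi := hd.inner ℂ hd
  have hre : HasDerivAt (fun s => (⟪V s, V s⟫_ℂ).re) (Complex.reCLM (⟪V t, D⟫_ℂ + ⟪D, V t⟫_ℂ)) t :=
    Complex.reCLM.hasFDerivAt.comp_hasDerivAt t hi
  have hfun : (fun s => ‖V s‖ ^ 2) = fun s => (⟪V s, V s⟫_ℂ).re := by
    funext s
    exact (inner_self_eq_norm_sq (𝕜 := ℂ) (V s)).symm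
  rw [hfun]
  refine hre.congr_deriv ?_
  rw [Complex.reCLM_apply, ← inner_conj_symm D (V t), Complex.add_re, Complex.conj_re, hD,
    inner_add_right, inner_smul_right, Complex.add_re]
  ring

/-- **Derivative of a coefficient along the band flow**: `∂ₜ ⟪φ, V⟫ = ⟪φ, L_R V⟫ + g ⟪φ, 1_R(D)ψ⟫`
(Tao p. 22: "if we take inner products of (4.15) with `ψ_{i,n}`"). [cite: Tao2016AveragedNS, §4 p. 22 (4.10)] -/
theorem hasDerivAt_inner_duhamelV (hg : Continuous g) (φ : L2C) (t : ℝ) :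
    HasDerivAt (fun s => ⟪φ, duhamelV hR hρ g x₀ ψ s⟫_ℂ)
      (⟪φ, bandLaplace hR hρ (duhamelV hR hρ g x₀ ψ t)⟫_ℂ + g t * ⟪φ, bandProj hR ψ⟫_ℂ) t := by
  have hd := hasDerivAt_duhamelV hR hρ hg x₀ ψ t
  have hi := (hasDerivAt_const t φ).inner ℂ hd
  rw [inner_zero_left, add_zero, inner_add_right, inner_smul_right] at hi
  exact hi

/-- The initial value of the Duhamel flow: `V(0) = 1_R(D) x₀`. [folklore] -/
theorem duhamelV_zero : duhamelV hR hρ g x₀ ψ 0 = bandProj hR x₀ := by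
  unfold duhamelV duhamelW
  rw [intervalIntegral.integral_same, add_zero, bandHeat_zero]

end Duhamel

end Band

end Literature.Analysis.FluidPDE.Tao2016
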